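import Summits.BirchSwinnertonDyer.BirchSwinnertonDyer.Theorems.SignedLowerHalvesSmallImageLowerHalfBothSignsRttD2J1CyclotomicCarrier
import Summits.BirchSwinnertonDyer.BirchSwinnertonDyer.Theorems.PrintCf2RubinValueTwoRowTwoLevelFinite
import Summits.BirchSwinnertonDyer.BirchSwinnertonDyer.Theorems.ResidualThetaTransportAtTwoResidualSignedLambdaLowerCMAtTwoCofreeTorsionFinite
import Literature.AnabelianGeometry.AbsoluteAnabelian.LocalResidueMapQmodZ
import Mathlib.RingTheory.Finiteness.Cardinality
import Mathlib.RingTheory.TensorProduct.Finite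
import HarnessLib

/-!
# Route `SignedLowerHalves`, crux L `SmallImageLowerHalfBothSigns` (stmt-BirchSwinnertonDyer-23599), line `rtt_w3` v14 → v15 — E2, row J3
# (Galois side, part β₇): THE LAYER GROUPS `H¹(G_P(K_n), 𝒪 ⊗ μ_{p^k} ⊗ θ′)` ARE FINITE (the Kőnig input `hfin` of `exists_junction_exact_of_layerPairing`)

WIDTH seat `bsd-line-slh-p3-w3` g22 under LEAD `cruxlead-stmt-BirchSwinnertonDyer-23599` g11 (cell `bsd-ssimc`); helper `--supports stmt-BirchSwinnertonDyer-23599`. THEOREMS ONLY.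
HONEST FRAMING: finiteness bookkeeping for the input `hfin : ∀ n k, Finite (cycLayerCohO S κ θ′ P n k 1)` of the J3 assembly (p784993) — the `𝒪`-twin of cf2c's `finite_levelCoh_one`
(Serre III §4.1 Prop. 8 on the type-(F) group `(U_n)_P`, Hermite) once `𝒪 ⊗_ℤ μ_{p^k}` is finite (`𝒪` is module-finite over `ℤ_p`, here through `𝒪/p^k` finite for `[ℚ_p(S) : ℚ_p] < ∞`,
and `p^k` kills the tensor). Nothing about E2, crux L/M or BSD, which remain OPEN and are proved for NO curve.

* `finite_tensor_muCarrier`, `finite_oMuCarrier` — `𝒪 ⊗_ℤ μ_{p^k}(K̄)` is finite; ★ `finite_levelCohO_one` (`P` finite, `U` open), ★ `finite_cycLayerCohO_one`.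
References: [SerreGaloisCohomology1997] III §4.1 Prop. 8; [NeukirchANT1999] II (4.8); [JohnsonLeungKings2011] Def. 4.2.
-/

set_option autoImplicit false
set_option linter.dupNamespace false -- D-0017: single-problem summit, the namespace repeats the problem name by design
noncomputable section

open scoped Classical TensorProduct
open NumberField IsDedekindDomain Field

namespace Summit.BirchSwinnertonDyer.BirchSwinnertonDyer.Theorems.SmallImageRttD2Seq

open Literature.NumberTheory.EllipticCurves Literature.NumberTheory.GaloisRepresentations Literature.NumberTheory.GaloisRepresentations.DiscreteGaloisModule
  Literature.NumberTheory.ComplexMultiplication.EllipticUnits.JohnsonLeungKings2011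
  Summit.BirchSwinnertonDyer.BirchSwinnertonDyer.Theorems.SmallImageRttD2J1
  Summit.BirchSwinnertonDyer.BirchSwinnertonDyer.Theorems.PrintCf2.RowTwo

section Finite

variable {K : Type} [Field K] [NumberField K] {p : ℕ} [Fact p.Prime] (S : Set (PadicAlgCl p)) [FiniteDimensional ℚ_[p] (padicCoeffField S)]

omit [NumberField K] in
/-- **`𝒪 ⊗_ℤ μ_{p^k}(K̄)` is finite**: a finitely generated `𝒪`-module (base change of the finite `ℤ`-module `μ_{p^k}`) killed by `p^k`, hence a finitely generated module over the
finite ring `𝒪/p^k`. [cite: NeukirchANT1999, Ch. II (4.8)] -/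
theorem finite_tensor_muCarrier (k : ℕ) : Finite ((padicCoeffIntegers S) ⊗[ℤ] MuCarrier K (p ^ k)) := by
  haveI : NeZero (p ^ k) := ⟨pow_ne_zero _ (Fact.out : p.Prime).ne_zero⟩
  haveI : Module.Finite ℤ (MuCarrier K (p ^ k)) := Module.Finite.of_finite
  haveI : Module.Finite (padicCoeffIntegers S) ((padicCoeffIntegers S) ⊗[ℤ] MuCarrier K (p ^ k)) := inferInstance
  -- `p^k` kills the tensor product
  have htors : Module.IsTorsionBySet (padicCoeffIntegers S) ((padicCoeffIntegers S) ⊗[ℤ] MuCarrier K (p ^ k))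
      (Ideal.span {((p : ℕ) : padicCoeffIntegers S) ^ k} : Ideal (padicCoeffIntegers S)) := by
    rw [Module.isTorsionBySet_span_singleton_iff]
    intro x
    induction x using TensorProduct.induction_on with
    | zero => exact smul_zero _
    | tmul a w =>
      rw [TensorProduct.smul_tmul', smul_eq_mul, ← Nat.cast_pow, ← nsmul_eq_mul, TensorProduct.smul_tmul]
      have hw : (p ^ k) • w = 0 := muVal_injective K (p ^ k) (by rw [muVal_nsmul, muVal_pow_eq_one, muVal_zero])
      rw [hw, TensorProduct.tmul_zero]
    | add x y hx hy => rw [smul_add, hx, hy, add_zero]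
  letI := htors.module
  haveI : Module.Finite (padicCoeffIntegers S ⧸ (Ideal.span {((p : ℕ) : padicCoeffIntegers S) ^ k} : Ideal (padicCoeffIntegers S)))
      ((padicCoeffIntegers S) ⊗[ℤ] MuCarrier K (p ^ k)) :=
    Module.Finite.of_restrictScalars_finite (padicCoeffIntegers S) _ _
  haveI := LambdaLowerBoundO.finite_quotient_span_natCast_prime_pow_padicCoeffIntegers S k
  exact Module.finite_of_finite (padicCoeffIntegers S ⧸ (Ideal.span {((p : ℕ) : padicCoeffIntegers S) ^ k} : Ideal (padicCoeffIntegers S)))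

omit [NumberField K] in
/-- **honda's coefficient carrier `𝒪 ⊗ μ_{p^k}` (`OMuCarrier`) is finite.** [cite: JohnsonLeungKings2011, Def. 4.2] [cite: NeukirchANT1999, Ch. II (4.8)] -/
theorem finite_oMuCarrier (k : ℕ) : Finite (OMuCarrier K S (p ^ k)) :=
  finite_tensor_muCarrier S k

variable (θ : absoluteGaloisGroup K →ₜ* (padicCoeffIntegers S)ˣ) (P : Set (HeightOneSpectrum (𝓞 K)))

/-- ★ **`H¹(G_P(F), (𝒪 ⊗ μ_{p^k} ⊗ θ)^{N_P})` is finite** for `P` finite and `F = K̄^U`, `U` open (Serre III §4.1 Prop. 8 on the type-(F) group `U_P`, the tree's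
`ContinuousRep.finite_continuousCohomology_one` + cf2c's `finite_setOf_isOpen_index_le_imGS`). [cite: SerreGaloisCohomology1997, Ch. III §4.1, Prop. 8] [cite: JohnsonLeungKings2011, Def. 4.2] -/
theorem finite_levelCohO_one (hP : P.Finite) {U : Subgroup (absoluteGaloisGroup K)} (hU : IsOpen (U : Set (absoluteGaloisGroup K))) (k : ℕ) :
    Finite (levelCohO S P θ U k 1) := by
  haveI : CompactSpace (imGS P U) :=
    isCompact_iff_compactSpace.mp (Subgroup.isClosed_of_isOpen _ (isOpenMap_toUnramifiedQuot K P _ hU)).isCompact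
  haveI := finite_oMuCarrier (K := K) S k
  exact (levelRepO S P θ U k).finite_continuousCohomology_one (finite_setOf_isOpen_index_le_imGS P hP hU)

/-- ★ **The layer groups `H¹(G_P(K_n), 𝒪 ⊗ μ_{p^k} ⊗ θ)` of the cyclotomic tower are finite** (`P` finite) — the input `hfin` of `exists_junction_exact_of_layerPairing` (p784993).
[cite: SerreGaloisCohomology1997, Ch. III §4.1, Prop. 8] [cite: Kato2004Asterisque, §17.13] -/
theorem finite_cycLayerCohO_one (κ : ZpExtension K p) (hP : P.Finite) (n k : ℕ) : Finite (cycLayerCohO S κ θ P n k 1) :=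
  finite_levelCohO_one S θ P hP (κ.isOpen_layerSubgroup n) k

end Finite

end Summit.BirchSwinnertonDyer.BirchSwinnertonDyer.Theorems.SmallImageRttD2Seq

end
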